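import Summits.BirchSwinnertonDyer.BirchSwinnertonDyer.Theorems.CongruentShaFreeCutKatoZetaRoadLogZero
import HarnessLib

set_option linter.dupNamespace false
set_option autoImplicit false

/-! # Route `CongruentShaFreeCut` (rung S2) — crux B `AnalyticRankOneOfRankOneFiniteShaTwo`
# (stmt-BirchSwinnertonDyer-19080): the NAMED research statement `LogZeroAtTwoH2` = (V₂), the annihilation half of
# Perrin-Riou's formula at the additive prime `2` of `E_n`, and the two by-name doors of the v1i design

Cell `bsd-cn100`, prover seat `bsd-cn100-s2-c3` (g17), under plan g22 RULING-1 (the LogZero design ADOPTED for the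
line `kato-zeta-perrin-riou` of stmt-BirchSwinnertonDyer-19080; named-def condition). ONE `@[conjecture] def` (a research
statement of the route, D-0014: a `Prop`, nothing asserted, nothing proved about it) + THEOREMS; supports, does not
close, stmt-BirchSwinnertonDyer-19080; no registry act is performed here (the plan's). PARTITION: none — RANK axis.

* `LogZeroAtTwoH2 : Prop` — (V₂), body TOKEN-IDENTICAL to the hypothesis schema `hV` of
  `CongruentShaFreeCutKatoZetaRoadLogZero` (p530262) §2–§4: for square-free `n`, a Heegner field `K` of
  `(N(E_n), 2)` with `L(E_n^{(d_K)}, 1) ≠ 0`, a TORSION Heegner point `P ∈ E_n(K)` of level `N`, `L(E_n, 1) = 0`: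
  every v2-pinned Kato descent datum `D` of `(E_n, 2)` with Kato's Main Conjecture 12.10 in `Λ ⊗ ℚ₂` has
  `HasLocPKummerLog (E_n) 2 pin.katoClass 0`.
* `logZeroH2_of_prFormulaH2 : PRFormulaAtTwoH2 → LogZeroAtTwoH2` — ACT TEST (i) (the registered v1h research stub
  implies the new one; `…LogZero.logZeroAtTwo_of_prFormulaH2` by name). The converse is not claimed.
* `cruxB_of_registeredRI7prime_of_logZeroH2 (RI : RI7′ verbatim) (hV : LogZeroAtTwoH2) :
  AnalyticRankOneOfRankOneFiniteShaTwo` — ACT TEST (ii) (the two v1i stubs are jointly sufficient for crux B BY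
  NAME; `…LogZero.cruxB_of_RI7prime_of_logZero` by name).
* `cruxB_of_logZeroH2_of_readings_rankOne` — the readings form (`hKato`, (R+K) `hRK` under the crux hypotheses,
  (3.1′) `h31`, (3.1″) `h31b`, `hV : LogZeroAtTwoH2`), the composition a v1i body's `_of_stubs` may call.

HONEST FRAMING. `LogZeroAtTwoH2` is OPEN — 0 printed sources at the additive prime `2` (Perrin-Riou 1993 states Conj.
3.3.2 at primes of good reduction; Burungale–Skinner–Tian–Wan 2024 Thm. 1.13 needs `p ∤ 2N`; Bertolini–Darmon–Venerucci
2022 Thm. A is semistable at ODD `p` — `p = 2` is doubly outside; Delbourgo 2002's non-semistable `p`-adic BSD needs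
potentially ORDINARY reduction at `p ≥ 5`, while `E_n` is potentially supersingular at `2`; cell record LIT-G18 §1).
Naming it does not make it more provable; it is WEAKER than `PRFormulaAtTwoH2` only in that it drops the non-vanishing
half (`c ≠ 0`) and the embedding datum `ι : K → ℚ₂`, which the road never used. Nothing about `LogZeroAtTwoH2`,
`PRFormulaAtTwoH2`, the seven citation-borne inputs RI7′, crux B, the leaf `rankOne_twoConverse_congruentNumber`, the
congruent number problem in 100 % of cases or any case of BSD is proved here; BSD is not proved by any of this.

References: [PerrinRiou1993AIF] B. Perrin-Riou, Ann. Inst. Fourier 43 (1993), §3.3, Prop. 3.3.1, Conj. 3.3.2, Formule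
3.3.4 (pp. 975–977); [BurungaleSkinnerTianWan2024] arXiv:2409.01350, Conj. 1.12 (a)+(b), Thm. 1.13;
[BertoliniDarmonVenerucci2022] Thm. A (1)–(2); [AlpogeBhargavaShnidman2022] App. A (Burungale–Skinner) Thm. 10.8 (a)
(p. 33), §10.1.3, §2 after Thm. 2.10; [Kato2004Asterisque] Conj. 12.10 (p. 224), §14.14 (14.14.1) (p. 243), Cor. 14.3;
[Delbourgo2002] J. Number Theory 95 (2002) 38–71, Hypothesis p. 39; [GrossZagier1986] Thm. I.6.3.
-/

noncomputable section

open scoped Classical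

open WeierstrassCurve NumberField IsDedekindDomain Field Literature.NumberTheory.EllipticCurves
  Literature.NumberTheory.EllipticCurves.Rank1Residual Literature.NumberTheory.EllipticCurves.Kato2004
  Literature.NumberTheory.EllipticCurves.Kato2004.EulerSystemValues Literature.NumberTheory.EllipticCurves.Castella2018
  Literature.NumberTheory.GaloisRepresentations Summit.BirchSwinnertonDyer.Rank1Residual.Additive
  Summit.BirchSwinnertonDyer.BirchSwinnertonDyer.Theses.CongruentShaFreeCut
  Summit.BirchSwinnertonDyer.BirchSwinnertonDyer.Theorems.CongruentShaFreeCutKatoDescentDatumOfH2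
  Summit.BirchSwinnertonDyer.BirchSwinnertonDyer.Theorems.CongruentShaFreeCutKatoZetaRoadPinnedH2
open Summit.BirchSwinnertonDyer.BirchSwinnertonDyer.Theorems.CongruentShaFreeCutKatoZetaRoadLogZero
  (logZeroAtTwo_of_prFormulaH2 cruxB_of_RI7prime_of_logZero cruxB_of_logZero_of_readings_rankOne)

namespace Summit.BirchSwinnertonDyer.BirchSwinnertonDyer.Theorems.CongruentShaFreeCutKatoZetaRoadLogZeroH2

/-! ## §1 The named research statement (V₂) -/

/-- **`LogZeroAtTwoH2` — (V₂), the ANNIHILATION HALF of Perrin-Riou's formula for Kato's zeta element of `E_n` at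
the ADDITIVE prime `2`, over the v2 pin** (OPEN; `@[conjecture]`, nothing asserted). For every square-free `n`, every
imaginary quadratic `K` with the Heegner hypothesis for `N = N(E_n)` and for `2` and with `L(E_n^{(d_K)}, 1) ≠ 0`,
every Heegner point `P ∈ E_n(K)` of level `N` which is TORSION: if `L(E_n, 1) = 0` then for every PINNED Kato
descent datum `D` of `(E_n, 2)` (`KatoDescentDatumPinH2`) satisfying Kato's Main Conjecture 12.10 in `Λ ⊗ ℚ₂` the
localisation at `2` of (a non-zero multiple of) the pinned Kato class is the Kummer class of a point of `E_n(ℚ₂)`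
of logarithm `0` — `HasLocPKummerLog (E_n) 2 pin.katoClass 0`. READING: by Gross–Zagier + Kolyvagin over `K` and
`L(E_n^{(d_K)}, 1) ≠ 0`, «`P` torsion» is «`ord_{s=1} L(E_n, s) ≠ 1`», i.e. (with `L(E_n, 1) = 0` and the sign
forced by the Heegner hypothesis) «`ord_{s=1} L(E_n, s) ≥ 3`»; so this is, for the congruent number curves at
`p = 2` and in the local Kummer currency, the (⟹) half of Perrin-Riou's Conjecture 3.3.2 («`L(f,s)` a un zéro
d'ordre `> 1` en `1` ⟹ the bottom class of the zeta element vanishes», stated at primes of GOOD reduction) =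
Burungale–Skinner–Tian–Wan's Conj. 1.12 (a)+(b) read at `ord ≠ 1` (any `(E, p)`; their Thm. 1.13 proves it for
`p ∤ 2N`) = Bertolini–Darmon–Venerucci's Thm. A («`log_ω(res_p ζ^Kato) = c · log²_ω(P)`, `P` of infinite order iff
the zero is simple») read at a torsion `P` (proved for SEMISTABLE odd `p` only). `E_n` is ADDITIVE and potentially
supersingular at `2`: 0 sources (Delbourgo 2002's non-semistable theory is potentially ordinary, `p ≥ 5`). It is the
`hV` schema of `CongruentShaFreeCutKatoZetaRoadLogZero` token for token; implied by the v1h stub `PRFormulaAtTwoH2`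
(`logZeroH2_of_prFormulaH2`), from which it drops the non-vanishing half `c ≠ 0` and the embedding `ι : K → ℚ₂`
(both idle on the road); the converse is not claimed. NOT implied by crux B.
[cite: PerrinRiou1993AIF, §3.3, Conj. 3.3.2 and Formule 3.3.4 (pp. 975–977)]
[cite: BurungaleSkinnerTianWan2024, Conj. 1.12 (a)+(b) and Thm. 1.13] [cite: BertoliniDarmonVenerucci2022, Thm. A (1)–(2)]
[cite: AlpogeBhargavaShnidman2022, App. A Thm. 10.8 (a) (p. 33) and §2 after Thm. 2.10] -/
@[conjecture] def LogZeroAtTwoH2 : Prop :=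
  ∀ ⦃n : ℕ⦄, Squarefree n →
    ∀ [(congruentNumberCurve n).IsElliptic] [(congruentNumberCurve n).IsGloballyMinimal]
      [ContinuousSMul ℤ_[2] ((congruentNumberCurve n).tateModule 2)]
      (K : Type) [Field K] [NumberField K] (N : ℕ) [NeZero N],
      (congruentNumberCurve n).conductorNorm ℤ = N → IsImaginaryQuadratic K →
        SatisfiesHeegnerHypothesis N K → SatisfiesHeegnerHypothesis 2 K →
          ((congruentNumberCurve n).quadraticTwist (NumberField.discr K : ℚ)).entireLFunction 1 ≠ 0 →
      ∀ (P : ((congruentNumberCurve n).baseChange K).toAffine.Point),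
        IsHeegnerPoint N (congruentNumberCurve n) K P → IsOfFinAddOrder P →
          (congruentNumberCurve n).entireLFunction 1 = 0 →
      ∀ (D : KatoDescentDatum 2) (pin : KatoDescentDatumPinH2 (congruentNumberCurve n) 2 D),
        (∃ a b : ℕ,
          Ideal.span {((2 : ℕ) : IwasawaAlgebra 2) ^ a} * Module.charIdeal (IwasawaAlgebra 2) D.H2 =
            Ideal.span {((2 : ℕ) : IwasawaAlgebra 2) ^ b} *
              Module.charIdeal (IwasawaAlgebra 2) (D.H ⧸ (IwasawaAlgebra 2) ∙ D.z)) →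
        HasLocPKummerLog (congruentNumberCurve n) 2 pin.katoClass 0

/-- Unfolding `LogZeroAtTwoH2`: it IS the `hV` schema of `CongruentShaFreeCutKatoZetaRoadLogZero` (by `Iff.rfl`).
[cite: PerrinRiou1993AIF, §3.3, Conj. 3.3.2 (p. 976)] -/
theorem logZeroAtTwoH2_iff :
    LogZeroAtTwoH2 ↔
      ∀ ⦃n : ℕ⦄, Squarefree n →
        ∀ [(congruentNumberCurve n).IsElliptic] [(congruentNumberCurve n).IsGloballyMinimal]
          [ContinuousSMul ℤ_[2] ((congruentNumberCurve n).tateModule 2)]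
          (K : Type) [Field K] [NumberField K] (N : ℕ) [NeZero N],
          (congruentNumberCurve n).conductorNorm ℤ = N → IsImaginaryQuadratic K →
            SatisfiesHeegnerHypothesis N K → SatisfiesHeegnerHypothesis 2 K →
              ((congruentNumberCurve n).quadraticTwist (NumberField.discr K : ℚ)).entireLFunction 1 ≠ 0 →
          ∀ (P : ((congruentNumberCurve n).baseChange K).toAffine.Point),
            IsHeegnerPoint N (congruentNumberCurve n) K P → IsOfFinAddOrder P →
              (congruentNumberCurve n).entireLFunction 1 = 0 →
          ∀ (D : KatoDescentDatum 2) (pin : KatoDescentDatumPinH2 (congruentNumberCurve n) 2 D),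
            (∃ a b : ℕ,
              Ideal.span {((2 : ℕ) : IwasawaAlgebra 2) ^ a} * Module.charIdeal (IwasawaAlgebra 2) D.H2 =
                Ideal.span {((2 : ℕ) : IwasawaAlgebra 2) ^ b} *
                  Module.charIdeal (IwasawaAlgebra 2) (D.H ⧸ (IwasawaAlgebra 2) ∙ D.z)) →
            HasLocPKummerLog (congruentNumberCurve n) 2 pin.katoClass 0 :=
  Iff.rfl

/-! ## §2 ACT TEST (i): the registered research stub implies the named one -/

/-- **`PRFormulaAtTwoH2 → LogZeroAtTwoH2`** — the registered v1h research stub implies the v1i one (monotonicity, by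
name over `CongruentShaFreeCutKatoZetaRoadLogZero.logZeroAtTwo_of_prFormulaH2`: at a torsion Heegner point
`log_ω(P) = 0`, so Perrin-Riou's value `c · log_ω(P)²` is `0`; `c` and `c ≠ 0` unused). The converse is not claimed.
[cite: PerrinRiou1993AIF, §3.3, Conj. 3.3.2 and Formule 3.3.4 (pp. 976–977)] [cite: AlpogeBhargavaShnidman2022, App. A Thm. 10.8 (a) (p. 33)] -/
theorem logZeroH2_of_prFormulaH2 : PRFormulaAtTwoH2 → LogZeroAtTwoH2 :=
  fun hPR ↦ logZeroAtTwo_of_prFormulaH2 hPR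

/-! ## §3 ACT TEST (ii): the named stub and the registered citation bundle RI7′ give crux B by name -/

/-- **Crux B from the BUNDLED, REGISTERED RI7′ and `LogZeroAtTwoH2`.** `RI` is, token for token, the registered
signature of `stub_refereedInputs` on stmt-BirchSwinnertonDyer-19080 (2-parity, modularity, Hoffstein–Luo, Kato's
finiteness theorem, Heegner points over `K`, Gross–Zagier + Kolyvagin ∧ `Kato2004.one_le_rank_iwasawaH1`); `hV` is
the NAMED research statement. By name over `CongruentShaFreeCutKatoZetaRoadLogZero.cruxB_of_RI7prime_of_logZero`
(`LogZeroAtTwoH2` unfolds to its `hV` schema). The kernel certificate that the two stubs of a v1i skeleton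
{`stub_refereedInputs` = RI7′, `stub_logZeroAtTwo : LogZeroAtTwoH2`} are jointly sufficient for crux B BY NAME.
CONDITIONAL; closes nothing; nothing about RI7′ or `LogZeroAtTwoH2` is proved here.
[cite: Kato2004Asterisque, §12.2 (12.2.2) (p. 220), Cor. 14.3] [cite: DokchitserDokchitserAnnals2010, Thm. 1.4]
[cite: GrossZagier1986, Thm. I.6.3 with V.§2] [cite: PerrinRiou1993AIF, §3.3, Conj. 3.3.2] -/
theorem cruxB_of_registeredRI7prime_of_logZeroH2
    (RI : (∀ (W : WeierstrassCurve ℚ) [W.IsElliptic] (p : ℕ) [Fact p.Prime], p_parity W p) ∧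
      ModularForms.exists_isNewformOf ∧
      HoffsteinLuo1997_exists_twist_L_one_ne_zero ∧
      (∀ (W : WeierstrassCurve ℚ) [W.IsElliptic] (p : ℕ) [Fact p.Prime],
        kato_finite_of_L_one_ne_zero W p) ∧
      (∀ (W : WeierstrassCurve ℚ) (K : Type) [Field K] [NumberField K], exists_isHeegnerPoint W K) ∧
      (∀ (W : WeierstrassCurve ℚ) (N : ℕ) [NeZero N] (K : Type) [Field K] [NumberField K],
        analyticRankEK_eq_one_iff_heegner_nonTorsion W N K) ∧
      one_le_rank_iwasawaH1)
    (hV : LogZeroAtTwoH2) :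
    AnalyticRankOneOfRankOneFiniteShaTwo :=
  cruxB_of_RI7prime_of_logZero RI hV

/-! ## §4 The readings form (the composition a v1i body's `_of_stubs` calls) -/

/-- **Crux B on the v2-pinned Kato–zeta road from the readings and `LogZeroAtTwoH2`.** Displayed hypotheses: the six
refereed facts of the line of record, Kato's finiteness theorem among them, the three print readings (R+K) `hRK`
(asked under the crux hypotheses), (3.1′) `h31`, (3.1″) `h31b`, and the NAMED research statement `hV : LogZeroAtTwoH2`;
by name over `CongruentShaFreeCutKatoZetaRoadLogZero.cruxB_of_logZero_of_readings_rankOne` (p530262). CONDITIONAL;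
closes nothing. [cite: AlpogeBhargavaShnidman2022, App. A Thm. 10.1, Thm. 10.6, §10.1.3 (pp. 33–34)]
[cite: Kato2004Asterisque, Conj. 12.10, §14.14, Cor. 14.3] [cite: PerrinRiou1993AIF, §3.3, Conj. 3.3.2] -/
theorem cruxB_of_logZeroH2_of_readings_rankOne
    (hpar : ∀ (W : WeierstrassCurve ℚ) [W.IsElliptic] (p : ℕ) [Fact p.Prime], p_parity W p)
    (hmod : ModularForms.exists_isNewformOf) (hHL : HoffsteinLuo1997_exists_twist_L_one_ne_zero)
    (hKato : ∀ (W : WeierstrassCurve ℚ) [W.IsElliptic] (p : ℕ) [Fact p.Prime],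
      kato_finite_of_L_one_ne_zero W p)
    (hHP : ∀ (W : WeierstrassCurve ℚ) (K : Type) [Field K] [NumberField K],
      exists_isHeegnerPoint W K)
    (hGZ : ∀ (W : WeierstrassCurve ℚ) (N : ℕ) [NeZero N] (K : Type) [Field K] [NumberField K],
      analyticRankEK_eq_one_iff_heegner_nonTorsion W N K)
    (hRK : ∀ ⦃n : ℕ⦄, Squarefree n →
      ∀ [(congruentNumberCurve n).IsElliptic] [(congruentNumberCurve n).IsGloballyMinimal]
        [ContinuousSMul ℤ_[2] ((congruentNumberCurve n).tateModule 2)],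
        (congruentNumberCurve n).mordellWeilRank = 1 →
          Finite (AddCommGroup.primaryComponent (congruentNumberCurve n).sha 2) →
        ∃ D : KatoDescentDatum 2, Nonempty (KatoDescentDatumPinH2 (congruentNumberCurve n) 2 D) ∧
          ∃ a b : ℕ,
            Ideal.span {((2 : ℕ) : IwasawaAlgebra 2) ^ a} * Module.charIdeal (IwasawaAlgebra 2) D.H2 =
              Ideal.span {((2 : ℕ) : IwasawaAlgebra 2) ^ b} *
                Module.charIdeal (IwasawaAlgebra 2) (D.H ⧸ (IwasawaAlgebra 2) ∙ D.z))
    (h31 : ∀ ⦃n : ℕ⦄, Squarefree n →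
      ∀ [(congruentNumberCurve n).IsElliptic] [(congruentNumberCurve n).IsGloballyMinimal]
        [ContinuousSMul ℤ_[2] ((congruentNumberCurve n).tateModule 2)]
        (D : KatoDescentDatum 2), Nonempty (KatoDescentDatumPinH2 (congruentNumberCurve n) 2 D) →
        (congruentNumberCurve n).mordellWeilRank = 1 →
          Finite (AddCommGroup.primaryComponent (congruentNumberCurve n).sha 2) →
            Finite (IwasawaAlgebra.coinvariants 2 D.H2))
    (h31b : ∀ ⦃n : ℕ⦄, Squarefree n →
      ∀ [(congruentNumberCurve n).IsElliptic] [(congruentNumberCurve n).IsGloballyMinimal]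
        [ContinuousSMul ℤ_[2] ((congruentNumberCurve n).tateModule 2)]
        (D : KatoDescentDatum 2) (pin : KatoDescentDatumPinH2 (congruentNumberCurve n) 2 D),
        (congruentNumberCurve n).mordellWeilRank = 1 →
          Finite (AddCommGroup.primaryComponent (congruentNumberCurve n).sha 2) →
            (∀ m : ℕ, 2 ^ m • D.ι (Submodule.Quotient.mk D.z) ≠ 0) →
              ∀ t : ℚ_[2], HasLocPKummerLog (congruentNumberCurve n) 2 pin.katoClass t → t ≠ 0)
    (hV : LogZeroAtTwoH2) :
    AnalyticRankOneOfRankOneFiniteShaTwo :=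
  cruxB_of_logZero_of_readings_rankOne hpar hmod hHL hKato hHP hGZ hRK h31 h31b hV

end Summit.BirchSwinnertonDyer.BirchSwinnertonDyer.Theorems.CongruentShaFreeCutKatoZetaRoadLogZeroH2

end
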